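import Summits.MatrixMultiplication.MatrixMultiplication.Theses.ApproximationProfile

/-!
# Crux `Rigidity` (stmt-MatrixMultiplication-5014) — `Lines/birth.lean`, the BC3 birth skeleton

Route `ApproximationProfile` (route-MatrixMultiplication-ApproximationProfile; deciding theorem
`closes : Rigidity → Softness → MatrixMultiplication`, proved in the route file).  The crux, over the
tree's `tensorRank` / `matMulTensor` / `omega` (`Literature/…/MatrixMultiplicationExponent.lean`),
re-checked below as `rigidity_iff` (`Iff.rfl`):

  `Rigidity : ∀ η ∈ (0,1), ∀ β, [∃ C N, ∀ n ≥ N, ∃ S, R(S) ≤ C·n^β ∧ ‖⟨n,n,n⟩ − S‖² ≤ η·n³] → ω(ℂ) ≤ β`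

("ω^ap(η) = ω": approximating `⟨n,n,n⟩` to constant relative mean-square error buys no exponent).

## The line: flatten (η → θ) → snap (θ-approximant → exact `⟨m,m,m⟩`, `m ≥ n^{1−δ}`, rank × n^δ) → exponent

This is the route header's OWN foreseen split of the crux (TWO-LAYER PLAN: "Rigidity ⇐ Flatness →
Snap → Rigidity, where Snap is the small-error transfer"), made kernel-checked, with the exponent
bookkeeping that the header leaves implicit isolated as a third, provable stub:

* `stub_flatness` — **error amplification at constant rank cost**: the route's support item
  `Flatness` (stmt-MatrixMultiplication-5020) BY NAME: for `η ∈ (0,1)`, `η' > 0` there is `N` with: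
  every `S` within squared error `η n³` of `⟨n,n,n⟩` yields `S'`, `R(S') ≤ N·R(S)`, within `η' n³`.
  Why true (route header + refuter g40-12's corrected constant): rescale `S` so that the error is
  orthogonal to `⟨n,n,n⟩`; average `N` conjugates `gᵢ·S` over the stabiliser `U(n)³` (signed
  permutations suffice), whose invariants on `(ℂ^{n²})^{⊗3}` are `ℂ·⟨n,n,n⟩`; a random choice of the
  `gᵢ` kills the traceless error at rate `1/N`; `N ≥ η/((1−√η)² η')` works.  Size M, provable now.
* `stub_snap` — **small-error exact extraction (the engine; open)**: ONE threshold `θ > 0` such that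
  for every `δ > 0`, uniformly in large `n`, every `S` within `θ n³` of `⟨n,n,n⟩` "contains" an exact
  matrix product of polynomially comparable size at sub-polynomial rank loss:
  `∃ m ≥ n^{1−δ}, R(⟨m,m,m⟩) ≤ D_δ · n^δ · R(S)`.  Why it might hold: it follows from `ω = 2` with
  `LowerFrame` (`R(S) ≥ (1−θ)n²`, take `m = ⌈n^{1−δ}⌉`), so it is consistent with the summit; it is
  the uniform finite-`n` form of the crux's "transfer form" (route docstring of `Rigidity`).  Why it
  might fail: if `ω > 2`, perturbing an `θ`-fraction of the mass may genuinely lower the exponent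
  (support deletion lowers ranks: BiniEtAl1979; KarppaKaski2019), and the only transfers known are
  the incoherent `error × rank ≈ n³` (sketching) and Schönhage's theorem for EXACT 0/1 sub-patterns
  (BurgisserClausenShokrollahi1997 Thm (15.48) = support item `PatternRigidity`), which a dense error
  does not meet (no single product is computed exactly).  Size XL / open-problem — load-bearing.
* `stub_exponent` — **`ω` is blind to `n^{o(1)}` factors and to polynomially dense subsequences**:
  if for every `δ ∈ (0,1)`, for all large `n`, some `m ≥ n^{1−δ}` has `R(⟨m,m,m⟩) ≤ D_δ n^{β+δ}`,
  then `ω(ℂ) ≤ β`.  Why true: `ω ≤ log_m R(⟨m,m,m⟩)` for every `m ≥ 2` (tree: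
  `advxxz2025_omega_le_logb_of_tensorRank_le`, Bläser 2013 Thm 5.9), `log m ≥ (1−δ) log n`, so
  `ω ≤ (log D_δ + (β+δ) log n)/((1−δ) log n) → (β+δ)/(1−δ)`, then `δ → 0`; for `β < 2` the
  hypothesis is unsatisfiable at small `δ` (`R(⟨m,m,m⟩) ≥ m² ≥ n^{2−2δ}`, tree
  `matMulTensor_sq_le_tensorRank`), so the implication is vacuous there.  Size S/M, provable now.
* `rigidity_of_flatness_snap_exponent` — the sorry-free CORE with the three stub statements as
  explicit hypotheses: given `η, β, C, N`: apply the exponent lemma at `β`; for `δ ∈ (0,1)` flatten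
  `η → θ` (factor `M`), snap at `δ` (`D, N₀`); for `n ≥ max(N, N₀, 1)`:
  `R(⟨m,m,m⟩) ≤ D n^δ · R(S') ≤ D n^δ · M · C n^β = (D M C) · n^{β+δ}` with `m ≥ n^{1−δ}`.
* `Rigidity_of : Rigidity` — THE skeleton theorem: the crux BY NAME from the three declared stubs
  (the only `sorry`s of the file) through the core and the `Iff.rfl` bridge.

Honest status.  Given stubs 1 and 3 (both provable now), stub 2 implies the crux and is plausibly
STRONGER (one `θ` for all `δ`, a uniform constant `D_δ` over all approximants at each size, finite
`n`); the skeleton certifies the route's reduction "Rigidity ⇐ Flatness + Snap" and isolates the two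
provable pieces; it does not split the open content of the snap itself.  The alternative cut recorded
in the route header's NOT DECOMPOSED YET / refuter rreview note ("coherent error reduction η → η² at
O(1) rank cost", iterated to error `exp(−n^{δ'})·n³` at rank `× n^δ`, followed by a HIGH-PRECISION
snap) would replace `stub_snap` by two stubs (`SelfCorrection`, `PrecisionSnap`); it is noted in
`Lines/birth.md`, not registered here (one line per file).  Disproof used: none exists (`ledger crux
ls stmt-MatrixMultiplication-5014`: no workfiles, no `Disproof.lean`, no `Negative/` lemma; the 7
entries of `ledger negatives --problem MatrixMultiplication` concern STPP/design statements, none a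
Frobenius-error statement), so no `_false_without_` obligation applies.  Barriers honoured:
InfimumNotMinimumBarrier — every stub is asymptotic/uniform in `n` (`∀ δ`, all large `n`), no single
finite approximant certifies `ω`; LinearRankMethodBarrier — not in play (no lower bound is claimed).

BC3 probes (planner-run with `lean check`, `maxHeartbeats 400000`, files `bc/probe_stub*.lean` in the
planner folder): `stubᵢ → Rigidity` and `stubᵢ → _root_.MatrixMultiplication` for `i = 1, 2, 3`, each
as `example : S → T := by first | exact? | simpa | aesop` and in the in-context form
`example (h : S) : T := by first | exact? | simpa using h | aesop` — all must FAIL; verdicts quoted in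
`Lines/birth.md`.
-/

-- `Summit.<Summit>.<Problem>`: for the single-conjunct summit the duplicate component is mandated.
set_option linter.dupNamespace false

noncomputable section

namespace Summit.MatrixMultiplication.MatrixMultiplication.Cruxes.Rigidity.Birth

open scoped BigOperators
open Literature.Computability.AlgebraicComplexity
open Summit.MatrixMultiplication.MatrixMultiplication.Theses.ApproximationProfile (Rigidity Flatness)

/-! ## Bridge: the crux text, definitionally -/

/-- `Rigidity` is, definitionally, the transfer "rank-`O(n^β)` tensors within squared Frobenius error
`η n³` of `⟨n,n,n⟩` for all large `n` ⇒ `ω(ℂ) ≤ β`", for every `η ∈ (0,1)` and every real `β`.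
[folklore] -/
theorem rigidity_iff :
    Rigidity ↔
      ∀ η β : ℝ, 0 < η → η < 1 →
        (∃ C : ℝ, ∃ N : ℕ, ∀ n : ℕ, N ≤ n →
          ∃ S : Fin n × Fin n → Fin n × Fin n → Fin n × Fin n → ℂ,
            (tensorRank S : ℝ) ≤ C * (n : ℝ) ^ β ∧
            ∑ a, ∑ b, ∑ c, ‖matMulTensor ℂ n n n a b c - S a b c‖ ^ 2 ≤ η * (n : ℝ) ^ 3) →
        omega ℂ ≤ β :=
  Iff.rfl

/-! ## The three registered stubs (the only `sorry`s of this file) -/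

/-- **Stub 1 — flatness (error amplification at constant rank cost; the route's support item
`Flatness`, stmt-MatrixMultiplication-5020, BY NAME).**  For `η ∈ (0,1)` and `η' > 0` there is
`N = N(η, η')` such that every `S` with `‖⟨n,n,n⟩ − S‖² ≤ η n³` yields `S'` with `R(S') ≤ N · R(S)`
and `‖⟨n,n,n⟩ − S'‖² ≤ η' n³`.  Mechanism: rescale so that the error is orthogonal to `⟨n,n,n⟩`,
average `N` stabiliser-conjugates (`(X,Y,Z) ↦ (AXB⁻¹, BYC⁻¹, CZA⁻¹)`, signed permutation matrices
suffice: the invariants of this finite group on `(ℂ^{n²})^{⊗3}` are `ℂ·⟨n,n,n⟩`), a random choice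
kills the traceless error at rate `1/N`; `N ≥ η/((1−√η)² η')`.  Size M, provable now.
Sources: Blaser2013 (§4–5), DesilvaLim2008 (§1, §5), Mirsky1960. -/
theorem stub_flatness :
    Summit.MatrixMultiplication.MatrixMultiplication.Theses.ApproximationProfile.Flatness := by
  sorry

/-- **Stub 2 — snap: small-error exact extraction (the engine; open).**  There is ONE threshold
`θ > 0` such that for every `δ > 0` there are `D > 0` and `N₀` with: for all `n ≥ N₀`, every tensor
`S` within squared Frobenius error `θ n³` of `⟨n,n,n⟩` admits an exact matrix product of comparable
size at sub-polynomial rank loss — `∃ m ≥ n^{1−δ}` (as reals) with `R(⟨m,m,m⟩) ≤ D · n^δ · R(S)`.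
The uniform finite-`n` form of the crux's transfer form ("from an `η`-approximant of rank `r` at size
`n`, an exact `⟨m,m,m⟩` with `m ≥ n^{1−δ}` of rank `≤ C_δ n^δ r`"); consistent with the summit (it
follows from `ω = 2` and `LowerFrame`); any valid `θ` is automatically `< 1` (`S = 0`).  Why it might
fail: if `ω > 2` a dense `θ`-perturbation may lower the exponent (support deletion lowers ranks,
BiniEtAl1979, KarppaKaski2019); known transfers are incoherent (`error × rank ≈ n³`) or need EXACT
0/1 sub-patterns (Schönhage, BurgisserClausenShokrollahi1997 Thm (15.48)).  Size XL / open-problem.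
Sources: Schonhage1981, BurgisserClausenShokrollahi1997 (Thm (15.48)), BiniEtAl1979, KarppaKaski2019,
DesilvaLim2008. -/
theorem stub_snap :
    ∃ θ : ℝ, 0 < θ ∧ ∀ δ : ℝ, 0 < δ → ∃ D : ℝ, 0 < D ∧ ∃ N₀ : ℕ, ∀ n : ℕ, N₀ ≤ n →
      ∀ S : Fin n × Fin n → Fin n × Fin n → Fin n × Fin n → ℂ,
        ∑ a, ∑ b, ∑ c, ‖matMulTensor ℂ n n n a b c - S a b c‖ ^ 2 ≤ θ * (n : ℝ) ^ 3 →
        ∃ m : ℕ, (n : ℝ) ^ (1 - δ) ≤ (m : ℝ) ∧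
          (tensorRank (matMulTensor ℂ m m m) : ℝ) ≤ D * (n : ℝ) ^ δ * (tensorRank S : ℝ) := by
  sorry

/-- **Stub 3 — the exponent is blind to sub-polynomial losses in size and rank.**  For every real
`β`: if for every `δ ∈ (0,1)` there are `D, N₀` such that every `n ≥ N₀` has some `m ≥ n^{1−δ}` (as
reals) with `R(⟨m,m,m⟩) ≤ D · n^{β+δ}`, then `ω(ℂ) ≤ β`.  Proof sketch: for `m ≥ 2`,
`ω ≤ log_m R(⟨m,m,m⟩)` (`advxxz2025_omega_le_logb_of_tensorRank_le`, Bläser 2013 Thm 5.9) and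
`log m ≥ (1−δ) log n`, so `ω ≤ (log D + (β+δ) log n)/((1−δ) log n) → (β+δ)/(1−δ)` as `n → ∞`;
then `δ → 0⁺`.  For `β < 2` the hypothesis fails at small `δ` (`R(⟨m,m,m⟩) ≥ m² ≥ n^{2−2δ}`,
`matMulTensor_sq_le_tensorRank`), so the implication is vacuous there — no sign condition on `β`
or `D` is needed.  Size S/M, provable now.
Sources: Blaser2013 (Thm 5.9, Def 5.1), AlmanDuanVassilevskaWilliamsXuXuZhou2025 (§3.4),
BurgisserClausenShokrollahi1997 (Prop (15.1), (15.5)). -/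
theorem stub_exponent :
    ∀ β : ℝ,
      (∀ δ : ℝ, 0 < δ → δ < 1 → ∃ D : ℝ, ∃ N₀ : ℕ, ∀ n : ℕ, N₀ ≤ n →
        ∃ m : ℕ, (n : ℝ) ^ (1 - δ) ≤ (m : ℝ) ∧
          (tensorRank (matMulTensor ℂ m m m) : ℝ) ≤ D * (n : ℝ) ^ (β + δ)) →
      omega ℂ ≤ β := by
  sorry

/-! ## Sorry-free core -/

/-- **Composition with explicit hypotheses** (the BC3 shape `stub₁-sig → stub₂-sig → stub₃-sig →
crux-content`): from flatness (`hflat`, the route item `Flatness` by name), the snap (`hsnap`) and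
the exponent lemma (`hexp`), the transfer `η`-approximants of rank `O(n^β)` ⇒ `ω(ℂ) ≤ β` for every
`η ∈ (0,1)` and real `β`.  Proof: apply `hexp` at `β`; for `δ ∈ (0,1)` take `θ, D, N₀` from the snap
and `M` from flatness `η → θ`; for `n ≥ max (max N N₀) 1` the given approximant `S` (rank `≤ C n^β`)
flattens to `S'` (rank `≤ M·R(S)`, error `≤ θ n³`), which snaps to an exact `⟨m,m,m⟩`, `m ≥ n^{1−δ}`,
of rank `≤ D n^δ R(S') ≤ D n^δ M C n^β = (D M C) n^{β+δ}`.  Sorry-free, standard axioms. [folklore] -/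
theorem rigidity_of_flatness_snap_exponent
    (hflat : Summit.MatrixMultiplication.MatrixMultiplication.Theses.ApproximationProfile.Flatness)
    (hsnap : ∃ θ : ℝ, 0 < θ ∧ ∀ δ : ℝ, 0 < δ → ∃ D : ℝ, 0 < D ∧ ∃ N₀ : ℕ, ∀ n : ℕ, N₀ ≤ n →
      ∀ S : Fin n × Fin n → Fin n × Fin n → Fin n × Fin n → ℂ,
        ∑ a, ∑ b, ∑ c, ‖matMulTensor ℂ n n n a b c - S a b c‖ ^ 2 ≤ θ * (n : ℝ) ^ 3 →
        ∃ m : ℕ, (n : ℝ) ^ (1 - δ) ≤ (m : ℝ) ∧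
          (tensorRank (matMulTensor ℂ m m m) : ℝ) ≤ D * (n : ℝ) ^ δ * (tensorRank S : ℝ))
    (hexp : ∀ β : ℝ,
      (∀ δ : ℝ, 0 < δ → δ < 1 → ∃ D : ℝ, ∃ N₀ : ℕ, ∀ n : ℕ, N₀ ≤ n →
        ∃ m : ℕ, (n : ℝ) ^ (1 - δ) ≤ (m : ℝ) ∧
          (tensorRank (matMulTensor ℂ m m m) : ℝ) ≤ D * (n : ℝ) ^ (β + δ)) →
      omega ℂ ≤ β) :
    ∀ η β : ℝ, 0 < η → η < 1 →
      (∃ C : ℝ, ∃ N : ℕ, ∀ n : ℕ, N ≤ n →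
        ∃ S : Fin n × Fin n → Fin n × Fin n → Fin n × Fin n → ℂ,
          (tensorRank S : ℝ) ≤ C * (n : ℝ) ^ β ∧
          ∑ a, ∑ b, ∑ c, ‖matMulTensor ℂ n n n a b c - S a b c‖ ^ 2 ≤ η * (n : ℝ) ^ 3) →
      omega ℂ ≤ β := by
  intro η β hη0 hη1 hyp
  obtain ⟨C, N, hS⟩ := hyp
  obtain ⟨θ, hθ, hsnapθ⟩ := hsnap
  obtain ⟨M, hM⟩ := hflat η θ hη0 hη1 hθ
  apply hexp β
  intro δ hδ0 _hδ1
  obtain ⟨D, hD, N₀, hN₀⟩ := hsnapθ δ hδ0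
  refine ⟨D * M * C, max (max N N₀) 1, fun n hn => ?_⟩
  have hnN : N ≤ n := le_trans (le_trans (le_max_left _ _) (le_max_left _ _)) hn
  have hnN₀ : N₀ ≤ n := le_trans (le_trans (le_max_right _ _) (le_max_left _ _)) hn
  have hn1 : 1 ≤ n := le_trans (le_max_right _ _) hn
  have hn0 : (0 : ℝ) < (n : ℝ) := Nat.cast_pos.mpr (by omega)
  obtain ⟨S, hrank, herr⟩ := hS n hnN
  obtain ⟨S', hrank', herr'⟩ := hM n S herr
  obtain ⟨m, hm, hR⟩ := hN₀ n hnN₀ S' herr'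
  refine ⟨m, hm, hR.trans ?_⟩
  have hrank'' : (tensorRank S' : ℝ) ≤ (M : ℝ) * (tensorRank S : ℝ) := by
    exact_mod_cast hrank'
  have hDn : 0 ≤ D * (n : ℝ) ^ δ := mul_nonneg hD.le (Real.rpow_nonneg hn0.le _)
  calc D * (n : ℝ) ^ δ * (tensorRank S' : ℝ)
      ≤ D * (n : ℝ) ^ δ * ((M : ℝ) * (tensorRank S : ℝ)) :=
        mul_le_mul_of_nonneg_left hrank'' hDn
    _ ≤ D * (n : ℝ) ^ δ * ((M : ℝ) * (C * (n : ℝ) ^ β)) :=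
        mul_le_mul_of_nonneg_left (mul_le_mul_of_nonneg_left hrank (Nat.cast_nonneg M)) hDn
    _ = D * M * C * (n : ℝ) ^ (β + δ) := by
        rw [Real.rpow_add hn0]
        ring

/-! ## The composition: the three stubs prove the crux BY NAME -/

/-- **THE SKELETON THEOREM.** The crux
`Summit.MatrixMultiplication.MatrixMultiplication.Theses.ApproximationProfile.Rigidity`
(stmt-MatrixMultiplication-5014), concluded BY NAME from the three DECLARED stubs `stub_flatness`
(error amplification, route item `Flatness`), `stub_snap` (small-error exact extraction, the engine)
and `stub_exponent` (exponent bookkeeping) — the only `sorry`s of the file — through the sorry-free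
core `rigidity_of_flatness_snap_exponent` and the `Iff.rfl` bridge `rigidity_iff`. [folklore] -/
theorem Rigidity_of :
    Summit.MatrixMultiplication.MatrixMultiplication.Theses.ApproximationProfile.Rigidity :=
  rigidity_iff.mpr (rigidity_of_flatness_snap_exponent stub_flatness stub_snap stub_exponent)

end Summit.MatrixMultiplication.MatrixMultiplication.Cruxes.Rigidity.Birth

end
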